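import Literature.NumberTheory.QuadraticFields.ReducedQuadraticIrrationalsModules
import Mathlib.Data.Nat.Log
import HarnessLib

/-!
# Gauss reduction of a quadratic irrational to a reduced one in `O(log Q)` steps

Topic `NumberTheory/QuadraticFields`; continues `ReducedQuadraticIrrationalsModules.lean`
(`gaussStep`, `normalize`, `jmod`). Theorem-and-definition file (no named facts). Iterating the
Gauss step from admissible data `(P₀, Q₀)`, `Q₀ > 0`, divides `Q` by `4` while `Q ≥ 2√D` and then
reaches `Q² < D` in one more step, where `normalize` produces a reduced quotient; throughout, the
module `J = ℤ + φℤ` is multiplied by explicit, polynomially bounded factors. This is the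
reduction step of the infrastructure's giant step (Jozsa 2003, §6.2 Prop. 21: "`I_i` is reduced
for some `i ≤ ⌈log₂(a/√D)⌉ + 1` … `I_red = (1/α) I`"; Jacobson–Williams §5.2–§5.4: reduce the
product ideal, (5.12)/(5.38) for the size of the multiplier), in the Gauss/Lagrange variant whose
termination is elementary:

* `gaussMult n x` — the multiplier of `n` Gauss steps, `mem_jmod_gaussIter_iff`:
  `J(gaussStep^[n] x) = gaussMult n x · J(x)`;
* `sq_lt_or_pow_mul_le` — after `n` steps either `Q² < 4D` or `4ⁿ Q ≤ Q₀`; hence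
  **`gaussIter_Q_sq_lt`**: `Q² < D` after `K = log₄ Q₀ + 3` steps;
* `reduce x = normalize (gaussStep^[K] x)` is **reduced** (`isReduced_reduce`) with
  `J(reduce x) = reduceMult x · J(x)` (`mem_jmod_reduce_iff`) and the bounds
  `2^{-K} ≤ |reduceMult x| ≤ (Q₀ (√D + Q₀))^K` (`abs_reduceMult_le`, `le_abs_reduceMult`).

## References

* R. Jozsa, arXiv:quant-ph/0302134 (2003), §6.2 Prop. 21, §7 Prop. 33. [Jozsa2003]
* M. J. Jacobson, Jr., H. C. Williams, *Solving the Pell Equation*, Springer (2009), §5.1 (5.12),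
  §5.2, §5.4 (5.38). [JacobsonWilliams2008]
-/

noncomputable section

open scoped Classical

namespace Literature.NumberTheory.QuadraticFields

namespace QuadIrr

variable {D : ℕ}

/-! ### Iterated Gauss steps and their multiplier -/

/-- The multiplier of one Gauss step: `1` if the step is the identity, else `φ'` of the raw step.
[cite: JacobsonWilliams2008, §5.1 (5.4)] -/
def gaussFactor (x : QuadIrr D) : ℝ := if x.Q ^ 2 < D then 1 else (gaussRaw x).val

/-- The multiplier of `n` Gauss steps: `J(gaussStep^[n] x) = gaussMult n x · J(x)`.
[cite: JacobsonWilliams2008, §5.1 (5.10) (𝔞_j = θ_j 𝔞_1)] -/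
def gaussMult : ℕ → QuadIrr D → ℝ
  | 0, _ => 1
  | n + 1, x => gaussMult n (gaussStep x) * gaussFactor x

/-- Iterated Gauss steps of admissible data with `Q > 0` stay admissible with `Q > 0`.
[cite: Jozsa2003, §6.2 Prop. 21] -/
theorem gaussIter_spec (hD : ¬ IsSquare D) :
    ∀ (n : ℕ) {x : QuadIrr D}, x.IsAdmissible → 0 < x.Q →
      (gaussStep^[n] x).IsAdmissible ∧ 0 < (gaussStep^[n] x).Q
  | 0, _, h, hQ => ⟨h, hQ⟩
  | n + 1, _, h, hQ => by
    rw [Function.iterate_succ_apply]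
    obtain ⟨h1, h2⟩ := gaussStep_spec hD h hQ
    exact gaussIter_spec hD n h1 h2

/-- The module of one Gauss step: `J(gaussStep x) = gaussFactor x · J(x)`. [cite: JacobsonWilliams2008, §5.1 (5.4)–(5.5)] -/
theorem mem_jmod_gaussStep_iff' (hD : ¬ IsSquare D) {x : QuadIrr D} (h : x.IsAdmissible) (t : ℝ) :
    t ∈ jmod (gaussStep x) ↔ ∃ s ∈ jmod x, t = gaussFactor x * s := by
  unfold gaussFactor
  by_cases hx : x.Q ^ 2 < D
  · rw [gaussStep_of_sq_lt hx, if_pos hx]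
    constructor
    · intro ht; exact ⟨t, ht, by ring⟩
    · rintro ⟨s, hs, rfl⟩; simpa using hs
  · rw [if_neg hx]
    exact mem_jmod_gaussStep_iff hD h hx t

/-- **The module of `n` Gauss steps: `J(gaussStep^[n] x) = gaussMult n x · J(x)`.**
[cite: JacobsonWilliams2008, §5.1 (5.10)] -/
theorem mem_jmod_gaussIter_iff (hD : ¬ IsSquare D) :
    ∀ (n : ℕ) {x : QuadIrr D}, x.IsAdmissible → 0 < x.Q → ∀ t : ℝ,
      t ∈ jmod (gaussStep^[n] x) ↔ ∃ s ∈ jmod x, t = gaussMult n x * s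
  | 0, x, _, _, t => by
    simp only [Function.iterate_zero, id_eq, gaussMult, one_mul]
    exact ⟨fun ht => ⟨t, ht, rfl⟩, fun ⟨s, hs, hst⟩ => hst ▸ hs⟩
  | n + 1, x, h, hQ, t => by
    rw [Function.iterate_succ_apply]
    obtain ⟨h1, h2⟩ := gaussStep_spec hD h hQ
    rw [mem_jmod_gaussIter_iff hD n h1 h2 t]
    simp only [gaussMult]
    constructor
    · rintro ⟨s, hs, rfl⟩
      obtain ⟨s', hs', rfl⟩ := (mem_jmod_gaussStep_iff' hD h s).mp hs
      exact ⟨s', hs', by ring⟩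
    · rintro ⟨s', hs', rfl⟩
      exact ⟨gaussFactor x * s', (mem_jmod_gaussStep_iff' hD h _).mpr ⟨s', hs', rfl⟩, by ring⟩

/-! ### Termination in `O(log Q)` steps -/

/-- After `n` Gauss steps, either `Q² < 4D` or `4ⁿ Q ≤ Q₀`. [cite: Jozsa2003, §6.2 Prop. 21 (a_i < a_{i−1}/2)] -/
theorem sq_lt_or_pow_mul_le (hD : ¬ IsSquare D) :
    ∀ (n : ℕ) {x : QuadIrr D}, x.IsAdmissible → 0 < x.Q →
      (gaussStep^[n] x).Q ^ 2 < 4 * (D : ℤ) ∨ 4 ^ n * (gaussStep^[n] x).Q ≤ x.Q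
  | 0, x, _, _ => Or.inr (by simp)
  | n + 1, x, h, hQ => by
    rw [Function.iterate_succ_apply']
    obtain ⟨hn, hQn⟩ := gaussIter_spec hD n h hQ
    set y := gaussStep^[n] x with hy
    rcases sq_lt_or_pow_mul_le hD n h hQ with hlt | hle
    · left
      by_cases hsmall : y.Q ^ 2 < D
      · rw [gaussStep_of_sq_lt hsmall]; exact hlt
      · have := gaussStep_Q_sq_lt hD hn hQn (not_lt.mp hsmall) hlt
        linarith
    · by_cases hbig : 4 * (D : ℤ) ≤ y.Q ^ 2
      · right
        have := four_mul_gaussStep_Q_le hn hQn hbig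
        calc 4 ^ (n + 1) * (gaussStep y).Q = 4 ^ n * (4 * (gaussStep y).Q) := by ring
          _ ≤ 4 ^ n * y.Q := by apply mul_le_mul_of_nonneg_left this; positivity
          _ ≤ x.Q := hle
      · left
        push Not at hbig
        by_cases hsmall : y.Q ^ 2 < D
        · rw [gaussStep_of_sq_lt hsmall]; exact hbig
        · have := gaussStep_Q_sq_lt hD hn hQn (not_lt.mp hsmall) hbig
          linarith

/-- The number of Gauss steps used: `K = log₄ Q₀ + 3`. [cite: Jozsa2003, §6.2 Prop. 21 (i ≤ ⌈log₂(a/√D)⌉ + 1)] -/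
def gaussSteps (x : QuadIrr D) : ℕ := Nat.log 4 x.Q.toNat + 3

/-- **After `K = log₄ Q₀ + 3` Gauss steps, `Q² < D`.** [cite: Jozsa2003, §6.2 Prop. 21] -/
theorem gaussIter_Q_sq_lt (hD : ¬ IsSquare D) {x : QuadIrr D} (h : x.IsAdmissible) (hQ : 0 < x.Q) :
    (gaussStep^[gaussSteps x] x).Q ^ 2 < D := by
  set n := Nat.log 4 x.Q.toNat + 1 with hn
  have h4n : x.Q < 4 ^ n := by
    have := Nat.lt_pow_succ_log_self (b := 4) (by norm_num) x.Q.toNat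
    have hx : ((x.Q.toNat : ℕ) : ℤ) = x.Q := Int.toNat_of_nonneg hQ.le
    rw [← hx]; exact_mod_cast this
  -- after `n` steps `Q² < 4D`
  have hstep : (gaussStep^[n] x).Q ^ 2 < 4 * (D : ℤ) := by
    rcases sq_lt_or_pow_mul_le hD n h hQ with hlt | hle
    · exact hlt
    · exfalso
      have hQn := (gaussIter_spec hD n h hQ).2
      have : (4 : ℤ) ^ n ≤ 4 ^ n * (gaussStep^[n] x).Q := le_mul_of_one_le_right (by positivity) hQn
      linarith
  -- two more steps give `Q² < D` (one suffices; the second is then the identity)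
  have hK : gaussSteps x = n + 1 + 1 := by simp [gaussSteps, hn]
  rw [hK, Function.iterate_succ_apply', Function.iterate_succ_apply']
  obtain ⟨hn1, hQn1⟩ := gaussIter_spec hD n h hQ
  have h1 : (gaussStep (gaussStep^[n] x)).Q ^ 2 < D := by
    by_cases hsmall : (gaussStep^[n] x).Q ^ 2 < D
    · rw [gaussStep_of_sq_lt hsmall]; exact hsmall
    · exact gaussStep_Q_sq_lt hD hn1 hQn1 (not_lt.mp hsmall) hstep
  rw [gaussStep_of_sq_lt h1]; exact h1

/-! ### The reduced representative and its multiplier -/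

/-- **The reduced representative** of the class of `x`: normalise after `K` Gauss steps.
[cite: Jozsa2003, §6.2 Prop. 21 (I_red)] -/
def reduce (x : QuadIrr D) : QuadIrr D := normalize (gaussStep^[gaussSteps x] x)

/-- The multiplier `α⁻¹` with `J(reduce x) = reduceMult x · J(x)`. [cite: Jozsa2003, §6.2 Prop. 21 (I_red = (1/α) I)] -/
def reduceMult (x : QuadIrr D) : ℝ := gaussMult (gaussSteps x) x

/-- **`reduce x` is reduced.** [cite: Jozsa2003, §6.2 Prop. 21] -/
theorem isReduced_reduce (hD : ¬ IsSquare D) {x : QuadIrr D} (h : x.IsAdmissible) (hQ : 0 < x.Q) :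
    (reduce x).IsReduced := by
  obtain ⟨hK, hQK⟩ := gaussIter_spec hD (gaussSteps x) h hQ
  have hsq := gaussIter_Q_sq_lt hD h hQ
  refine isReduced_normalize hD hK hQK ?_
  have hQK' : (0 : ℝ) ≤ (gaussStep^[gaussSteps x] x).Q := by exact_mod_cast hQK.le
  have : (((gaussStep^[gaussSteps x] x).Q : ℝ)) ^ 2 < D := by exact_mod_cast hsq
  exact (Real.lt_sqrt hQK').mpr this

/-- **`J(reduce x) = reduceMult x · J(x)`.** [cite: Jozsa2003, §6.2 Prop. 21 (I_red = (1/α) I)] -/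
theorem mem_jmod_reduce_iff (hD : ¬ IsSquare D) {x : QuadIrr D} (h : x.IsAdmissible) (hQ : 0 < x.Q) (t : ℝ) :
    t ∈ jmod (reduce x) ↔ ∃ s ∈ jmod x, t = reduceMult x * s := by
  unfold reduce reduceMult
  rw [mem_jmod_normalize_iff (gaussIter_spec hD _ h hQ).1.1]
  exact mem_jmod_gaussIter_iff hD _ h hQ t

/-! ### Bounds on the multiplier -/

/-- The raw step multiplier in the reduction regime `Q² ≥ D` is at least `1/2` in absolute value:
`|φ'| = Q/|√D − P'| ≥ Q/(√D + Q/2) ≥ 1/2`. [cite: JacobsonWilliams2008, §5.1 (5.12) (r/Q_0 < |θ_m|)] -/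
theorem half_le_abs_val_gaussRaw (hD : ¬ IsSquare D) {x : QuadIrr D} (h : x.IsAdmissible) (hQ : 0 < x.Q)
    (hmid : (D : ℤ) ≤ x.Q ^ 2) : 1 / 2 ≤ |(gaussRaw x).val| := by
  have hQ' : (0 : ℝ) < x.Q := by exact_mod_cast hQ
  have hmul := abs_val_stepWith_mul hD h hQ (gaussQuot x)
  rw [← gaussRaw] at hmul
  have hP := sq_gaussRaw_P_le hQ (x := x)
  have hP' : 4 * ((gaussRaw x).P : ℝ) ^ 2 ≤ (x.Q : ℝ) ^ 2 := by exact_mod_cast hP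
  have habsP : |((gaussRaw x).P : ℝ)| ≤ x.Q / 2 := by
    rw [abs_le]; constructor <;> nlinarith
  have hsD : Real.sqrt D ≤ x.Q := by
    have : (D : ℝ) ≤ (x.Q : ℝ) ^ 2 := by exact_mod_cast hmid
    calc Real.sqrt D ≤ Real.sqrt ((x.Q : ℝ) ^ 2) := Real.sqrt_le_sqrt this
      _ = x.Q := Real.sqrt_sq hQ'.le
  have hden : |Real.sqrt D - (gaussRaw x).P| ≤ 2 * x.Q := by
    have := abs_sub (Real.sqrt (D : ℝ)) ((gaussRaw x).P : ℝ)
    rw [abs_of_nonneg (Real.sqrt_nonneg _)] at this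
    linarith
  have hden0 : 0 < |Real.sqrt D - (gaussRaw x).P| := abs_pos.mpr (sub_ne_zero.mpr (sqrt_ne_intCast hD _))
  by_contra hlt
  push Not at hlt
  have h1 : 0 < (1 / 2 - |(gaussRaw x).val|) * |Real.sqrt D - (gaussRaw x).P| := mul_pos (by linarith) hden0
  linarith [h1, hmul, hden]

/-- The raw step multiplier is at most `Q (√D + Q)`: `|√D − P'| ≥ 1/(√D + |P'|)` as
`|D − P'²| ≥ 1`. [cite: JacobsonWilliams2008, §5.1 (5.12) (|θ_m| < 2)] -/
theorem abs_val_gaussRaw_le (hD : ¬ IsSquare D) {x : QuadIrr D} (h : x.IsAdmissible) (hQ : 0 < x.Q) :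
    |(gaussRaw x).val| ≤ x.Q * (Real.sqrt D + x.Q) := by
  have hQ' : (0 : ℝ) < x.Q := by exact_mod_cast hQ
  have hmul := abs_val_stepWith_mul hD h hQ (gaussQuot x)
  rw [← gaussRaw] at hmul
  set P' := (gaussRaw x).P with hP'def
  have hP := sq_gaussRaw_P_le hQ (x := x)
  have habsP : |(P' : ℝ)| ≤ x.Q / 2 := by
    have hP' : 4 * (P' : ℝ) ^ 2 ≤ (x.Q : ℝ) ^ 2 := by exact_mod_cast hP
    rw [abs_le]; constructor <;> nlinarith
  -- `|√D − P'| · (√D + |P'|) ≥ |D − P'²| ≥ 1`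
  have hone : (1 : ℝ) ≤ |(D : ℝ) - (P' : ℝ) ^ 2| := by
    have hne : (D : ℤ) - P' ^ 2 ≠ 0 := sub_sq_ne_zero hD _
    have : (1 : ℤ) ≤ |(D : ℤ) - P' ^ 2| := Int.one_le_abs hne
    exact_mod_cast this
  have hfac : |(D : ℝ) - (P' : ℝ) ^ 2| = |Real.sqrt D - P'| * |Real.sqrt D + P'| := by
    rw [← abs_mul]; congr 1; nlinarith [sqrt_sq (D := D)]
  have hsum : |Real.sqrt D + P'| ≤ Real.sqrt D + x.Q := by
    calc |Real.sqrt D + P'| ≤ |Real.sqrt D| + |(P' : ℝ)| := abs_add_le _ _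
      _ ≤ Real.sqrt D + x.Q := by rw [abs_of_nonneg (Real.sqrt_nonneg _)]; linarith
  have hden0 : 0 < |Real.sqrt D - P'| := abs_pos.mpr (sub_ne_zero.mpr (sqrt_ne_intCast hD _))
  -- `|φ'| = Q / |√D − P'| ≤ Q (√D + Q)` since `1/|√D − P'| ≤ |√D + P'| ≤ √D + Q`
  have hinv : 1 ≤ |Real.sqrt D - P'| * (Real.sqrt D + x.Q) := by
    calc (1 : ℝ) ≤ |Real.sqrt D - P'| * |Real.sqrt D + P'| := by rw [← hfac]; exact hone
      _ ≤ |Real.sqrt D - P'| * (Real.sqrt D + x.Q) := mul_le_mul_of_nonneg_left hsum hden0.le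
  have : |(gaussRaw x).val| = x.Q / |Real.sqrt D - P'| := by
    rw [eq_div_iff hden0.ne']; exact hmul
  rw [this, div_le_iff₀ hden0]
  nlinarith [hinv, hQ']

/-- The one-step multiplier is bounded below by `1/2` (or is `1`). [cite: JacobsonWilliams2008, §5.1 (5.12)] -/
theorem half_le_abs_gaussFactor (hD : ¬ IsSquare D) {x : QuadIrr D} (h : x.IsAdmissible) (hQ : 0 < x.Q) :
    1 / 2 ≤ |gaussFactor x| := by
  unfold gaussFactor
  split_ifs with hx
  · norm_num
  · exact half_le_abs_val_gaussRaw hD h hQ (not_lt.mp hx)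

/-- The one-step multiplier is bounded above by `max 1 (Q (√D + Q))`. [cite: JacobsonWilliams2008, §5.1 (5.12)] -/
theorem abs_gaussFactor_le (hD : ¬ IsSquare D) {x : QuadIrr D} (h : x.IsAdmissible) (hQ : 0 < x.Q) :
    |gaussFactor x| ≤ max 1 (x.Q * (Real.sqrt D + x.Q)) := by
  unfold gaussFactor
  split_ifs with hx
  · simp
  · exact (abs_val_gaussRaw_le hD h hQ).trans (le_max_right _ _)

/-- Along Gauss steps `Q` stays below `max Q₀ √D` (it is divided by `4` in the regime `Q ≥ 2√D`,
and drops below `√D` from the regime `√D ≤ Q < 2√D`). [cite: Jozsa2003, §6.2 Prop. 21] -/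
theorem gaussIter_Q_le (hD : ¬ IsSquare D) :
    ∀ (n : ℕ) {x : QuadIrr D}, x.IsAdmissible → 0 < x.Q →
      ((gaussStep^[n] x).Q : ℝ) ≤ max (x.Q : ℝ) (Real.sqrt D)
  | 0, x, _, _ => by simp
  | n + 1, x, h, hQ => by
    rw [Function.iterate_succ_apply']
    obtain ⟨hn, hQn⟩ := gaussIter_spec hD n h hQ
    have ih := gaussIter_Q_le hD n h hQ
    set y := gaussStep^[n] x with hy
    by_cases hsmall : y.Q ^ 2 < D
    · rw [gaussStep_of_sq_lt hsmall]; exact ih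
    · push Not at hsmall
      by_cases hbig : 4 * (D : ℤ) ≤ y.Q ^ 2
      · have h1 := four_mul_gaussStep_Q_le hn hQn hbig
        have h2 := (gaussStep_spec hD hn hQn).2
        have : ((gaussStep y).Q : ℝ) ≤ y.Q := by exact_mod_cast (by linarith : (gaussStep y).Q ≤ y.Q)
        exact this.trans ih
      · push Not at hbig
        have h1 := gaussStep_Q_sq_lt hD hn hQn hsmall hbig
        have h2 := (gaussStep_spec hD hn hQn).2
        have : ((gaussStep y).Q : ℝ) ≤ Real.sqrt D := by
          have hq0 : (0 : ℝ) ≤ (gaussStep y).Q := by exact_mod_cast h2.le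
          have : ((gaussStep y).Q : ℝ) ^ 2 < D := by exact_mod_cast h1
          calc ((gaussStep y).Q : ℝ) = Real.sqrt (((gaussStep y).Q : ℝ) ^ 2) := (Real.sqrt_sq hq0).symm
            _ ≤ Real.sqrt D := Real.sqrt_le_sqrt this.le
        exact this.trans (le_max_right _ _)

/-- **Upper bound on the reduction multiplier**: with `M = max Q₀ √D`,
`|reduceMult x| ≤ (max 1 (M (√D + M)))^K`. [cite: JacobsonWilliams2008, §5.4 (5.38)] -/
theorem abs_gaussMult_le (hD : ¬ IsSquare D) :
    ∀ (n : ℕ) {x : QuadIrr D}, x.IsAdmissible → 0 < x.Q →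
      |gaussMult n x| ≤ (max 1 (max (x.Q : ℝ) (Real.sqrt D) * (Real.sqrt D + max (x.Q : ℝ) (Real.sqrt D)))) ^ n
  | 0, x, _, _ => by simp [gaussMult]
  | n + 1, x, h, hQ => by
    simp only [gaussMult]
    obtain ⟨h1, hQ1⟩ := gaussStep_spec hD h hQ
    have ih := abs_gaussMult_le hD n h1 hQ1
    set M := max (x.Q : ℝ) (Real.sqrt D) with hM
    set M1 := max ((gaussStep x).Q : ℝ) (Real.sqrt D) with hM1
    have hM1M : M1 ≤ M := by
      have := gaussIter_Q_le hD 1 h hQ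
      simp only [Function.iterate_one] at this
      exact max_le this (le_max_right _ _)
    have hs : 0 ≤ Real.sqrt (D : ℝ) := Real.sqrt_nonneg _
    have hM10 : 0 ≤ M1 := le_max_of_le_right hs
    have hB : max 1 (M1 * (Real.sqrt D + M1)) ≤ max 1 (M * (Real.sqrt D + M)) :=
      max_le_max le_rfl (mul_le_mul hM1M (by linarith) (by positivity) (hM10.trans hM1M))
    have hfac := abs_gaussFactor_le hD h hQ
    have hfac' : |gaussFactor x| ≤ max 1 (M * (Real.sqrt D + M)) := by
      refine hfac.trans (max_le_max le_rfl ?_)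
      have hxM : (x.Q : ℝ) ≤ M := le_max_left _ _
      have hQ' : (0 : ℝ) ≤ x.Q := by exact_mod_cast hQ.le
      exact mul_le_mul hxM (by linarith) (by positivity) (hQ'.trans hxM)
    rw [abs_mul, pow_succ]
    have h0 : (0 : ℝ) ≤ max 1 (M * (Real.sqrt D + M)) := le_max_of_le_left zero_le_one
    exact mul_le_mul (ih.trans (pow_le_pow_left₀ (le_max_of_le_left zero_le_one) hB n)) hfac' (abs_nonneg _)
      (pow_nonneg h0 n)

/-- **Lower bound on the reduction multiplier**: `|gaussMult n x| ≥ 2^{-n}`. [cite: JacobsonWilliams2008, §5.1 (5.12)] -/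
theorem le_abs_gaussMult (hD : ¬ IsSquare D) :
    ∀ (n : ℕ) {x : QuadIrr D}, x.IsAdmissible → 0 < x.Q → (1 / 2 : ℝ) ^ n ≤ |gaussMult n x|
  | 0, x, _, _ => by simp [gaussMult]
  | n + 1, x, h, hQ => by
    simp only [gaussMult]
    obtain ⟨h1, hQ1⟩ := gaussStep_spec hD h hQ
    rw [abs_mul, pow_succ]
    exact mul_le_mul (le_abs_gaussMult hD n h1 hQ1) (half_le_abs_gaussFactor hD h hQ) (by positivity)
      (abs_nonneg _)

/-- `|reduceMult x| ≥ 2^{-K}`, `K = gaussSteps x`. [cite: JacobsonWilliams2008, §5.1 (5.12)] -/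
theorem le_abs_reduceMult (hD : ¬ IsSquare D) {x : QuadIrr D} (h : x.IsAdmissible) (hQ : 0 < x.Q) :
    (1 / 2 : ℝ) ^ gaussSteps x ≤ |reduceMult x| :=
  le_abs_gaussMult hD _ h hQ

/-- `|reduceMult x| ≤ (max 1 (M (√D + M)))^K`, `M = max Q₀ √D`, `K = gaussSteps x`. [cite: JacobsonWilliams2008, §5.4 (5.38)] -/
theorem abs_reduceMult_le (hD : ¬ IsSquare D) {x : QuadIrr D} (h : x.IsAdmissible) (hQ : 0 < x.Q) :
    |reduceMult x| ≤
      (max 1 (max (x.Q : ℝ) (Real.sqrt D) * (Real.sqrt D + max (x.Q : ℝ) (Real.sqrt D)))) ^ gaussSteps x :=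
  abs_gaussMult_le hD _ h hQ

/-- The reduction multiplier is nonzero. [folklore] -/
theorem reduceMult_ne_zero (hD : ¬ IsSquare D) {x : QuadIrr D} (h : x.IsAdmissible) (hQ : 0 < x.Q) :
    reduceMult x ≠ 0 := by
  have := le_abs_reduceMult hD h hQ
  have h0 : (0 : ℝ) < (1 / 2 : ℝ) ^ gaussSteps x := by positivity
  exact abs_pos.mp (h0.trans_le this)

end QuadIrr

end Literature.NumberTheory.QuadraticFields

end
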